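import Literature.MathematicalPhysics.QuantumFieldTheory.BalabanImbrieJaffe1984to88.BIJ88RT51Exists
import Literature.MathematicalPhysics.QuantumFieldTheory.BalabanImbrieJaffe1984to88.BIJ88RT51BlockGauge
import Literature.MathematicalPhysics.QuantumFieldTheory.BalabanImbrieJaffe1984to88.BIJ88GaugeAverage

/-!
# `BalabanImbrieJaffe1984to88.BIJ88RT51Invariant` — T. Bałaban, J. Imbrie, A. Jaffe, *Effective action and cluster properties of the
abelian Higgs model*, Commun. Math. Phys. **114** (1988) 257–315 [BalabanImbrieJaffe1988], Sect. 5.1 p. 277 [PDF 21] with Sect. 4 p. 277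
(4.17): **the density `ρ̃^L_{k+1}` of (5.1.1) has an EXACTLY block-field-gauge-INVARIANT version** — file 3/3 of seat p34 gen 6 (file 1/3
`BIJ88RT51Density`: the Radon–Nikodym engine; file 2/3 `BIJ88RT51Exists`: the constructed density `rt51` satisfies gen 5's typed (5.1.1)
`IsRT511`/`IsRT511Ax` and is the only `dv dψ`-integrable solution up to null sets).

statement-level skeleton of published theorems with citation tags; proofs where landed; nothing here is a claim about the Yang–Mills mass gap

PDF held: `paper:balaban1988-cmp114-bij-abelian-higgs-effective-action` (journal page = PDF page + 256); p. 277 [PDF 21] read as an image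
(r16's CCITT-G4 render `HOME/lit-balaban-r16/renders/cmp114/original-p021-x2.png`, re-read by this seat).

CITATION HEADER (lean-in-tree rule).  Part of the lit-balaban TYPED SKELETON (HOME `run/shared/lean/pub/lit-balaban/`), PHASE-2 proof seat
p34 gen 6 (unit `lit-balaban-p34-g6`; TAKING line HOME/STATUS.md 2026-08-21T07:13Z, free-target protocol G.5-34(d), own lineage = the C1/C2
renormalization-transformation line of seat p34).  Rows served: **`C2.Eq5.1.1-5.1.4`** (fold owner r16; the EXISTENCE half) together with the
support rows **`C2.Eq4.17`** (owner r18) / **`C2.Eq5.2.9`** (owner r16) already credited to gen 5's `BIJ88RT51BlockGauge` (block field gauge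
COVARIANCE of the operation (5.1.1)).

THE PRINTED TEXT (p. 277 [PDF 21], verbatim).  *"The second kind of gauge invariance is called block field gauge invariance, and is
invariance under u_b → u_b e^{−ie_k(∂λ)(b)}, φ(x) → e^{ie_kλ(x)}, u^{(j)}_b → u^{(j)}_b exp[−ie_kL^jη(∂^{L^jη}Q′*_{k−j}λ)(b)], if b ∈ Λ₁^{(j)*c},
u^{(j)}_b → u^{(j)}_b, otherwise, (4.17) for λ a function on T₁^{(k)}. … Here, however, the variables u and u^{(j)} are also transformed, but
in a way that does not affect the δ-functions giving the axial gauge conditions and gauge field renormalization transformations."* and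
*"5.1. Renormalization Transformation.  A density of ρ̃^L_{k+1}(v, ψ) is obtained by applying the renormalization transformations of [1] to
ρ′_k as follows: … (5.1.1)"*.

WHAT IS PROVED, and how (carriers of record as in files 1–2: levels `k`/`k + 1` of `Balaban1983to89.Setup`, `Prev`/`prevMeasure`, `𝒟u` =
`fieldMeasure`, `𝒟u δ_{Ax}` = r18's `axialMeasure`, `dv dψ`; the joint block-lattice gauge action `(v, ψ) ↦ (v^g, gψ)` = gen 4's
`BIJ88GaugeAverage.act`, the GAUGE AVERAGE `(gaugeAvg ρ)(v, ψ) = ∫dg ρ(v^g, gψ)` over the compact gauge group with its normalized Haar measure,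
exactly invariant by `jointInvariant_gaugeAvg` and a version of every a.e.-invariant density by `gaugeAvg_ae_eq`).
* §1 GENERIC.  A `dv dψ`-integrable, jointly measurable solution `ρ̃` of (5.1.1) ALL OF WHOSE block-gauge transforms `(v, ψ) ↦ ρ̃(v^g, gψ)` are
  again solutions (gen 5's `BIJ88RT51BlockGauge.isRT511_blockGauge` gives this under the printed covariances of (4.17)) is invariant under each
  `g` almost everywhere (`ae_invariant_of_isRT511`: both are integrable solutions — `𝒟v dψ` is preserved by the action, gen 4's
  `measurePreserving_act` — and gen 5's a.e. uniqueness `BIJ88RT51Unique.isRT511_unique`); hence its gauge average is an EXACTLY invariant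
  solution (`isRT511_gaugeAvg`: `gaugeAvg ρ̃ = ρ̃` a.e. and `isRT511_congr_ae`).  Axial versions `ae_invariant_of_isRT511Ax`, `isRT511Ax_gaugeAvg`.
* §2 FOR THE CONSTRUCTED DENSITY of file 2 (`rt51`): under the existence hypotheses (measurable Haar-regular `Qu`, jointly measurable and
  suitably integrable term data, `a > 0`, `d ≥ 2`) and the covariance hypotheses of gen 5's `isRT511_blockGauge` (`Qu` block-gauge covariant;
  for every term a `Π𝒟u^{(j)}`-preserving reparametrization `τ_t(g)` of the earlier fields — the third line of (4.17) — under which `ρ′_t` is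
  invariant and the background kernel `Q_t = Q(u_k)φ` covariant): `rt51_act_ae_eq` (the constructed density is a.e. invariant),
  **`isRT511_gaugeAvg_rt51`** (its gauge average satisfies (5.1.1)), **`exists_isRT511_jointInvariant`** — THERE IS a density satisfying (5.1.1)
  that is EXACTLY block-field gauge invariant, jointly measurable and `dv dψ`-integrable (the form in which the next step's Faddeev–Popov
  argument (5.1.4) — gen 5's `integral_axialMeasure_eq_of_pointed`, living on a `𝒟u`-null set — can use it; cf. gen 4's design note in
  `BIJ88RTIterated`).  Axial versions `rt51Ax_act_ae_eq`, `isRT511Ax_gaugeAvg_rt51`, `exists_isRT511Ax_jointInvariant` (standing range).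
* §2 also: the normalization `∫dv dψ ρ̃^L_{k+1} = Σ_t ∫𝒟u∫Π𝒟u^{(j)}∫𝒟φ ρ′_t` of the constructed density (`integral_rt51`).
* §3 PRINTED INSTANCE: for the printed gauge-field average `Qu` of [2] (2.10) (r18's `BIJ85BlockAveragesTorus.qU`: Haar regularity
  `map_qU_fieldMeasure`, block-gauge covariance `BIJ88BlockGauge417.qU_gaugeAct_blockConst`) and the (4.17)-SHAPED reparametrization of the earlier
  fields (gen 5's `BIJ88RT51NoChange.mulRightPrev w`, measure preserving for every prescription `w`): **`exists_isRT511_jointInvariant_printed`** —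
  only the two invariance identities of `ρ′_t`, `Q_t` under (4.17) and the measurability / integrability of the term data remain as hypotheses.
* §4 CONSISTENCY WITH THE FIRST STEP (`rt51_single_ae_eq_rt`): for one history-free term the general-step construction over `𝒟u δ_{Ax}` IS,
  up to a `dv dψ`-null set, gen 2's measure-level transform `BIJ85RT33.RTData.rt` of [2] (3.3) over r18's axial forest (both solve (3.11)).
NOT DONE HERE (honest scope).  As in gen 5's files the specific prescription `w` of (4.17) and the invariance of the concrete `ρ′_k`, `u_k` of
Sects. 4–5 under it are hypotheses (the background kernels, `u_k`, `{X_ω}`, `ρ′_k` are DATA); no bound.  Theorems only; re-declares nothing;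
imports Literature + Mathlib only; NO `Prop`-valued fact is introduced; standard axioms.
-/

namespace Literature.MathematicalPhysics.QuantumFieldTheory.BalabanImbrieJaffe1984to88.BIJ88RT51Invariant

open Literature.MathematicalPhysics.QuantumFieldTheory.Balaban1983to89
open BIJ88Sect3Statements (U1)
open BIJ85Sect1Model (HiggsField)
open BIJ85RT33 (JointInvariant twist)
open BIJ88RenormTransf311 (axialMeasure)
open BIJ88InductiveForm41 (Prev prevMeasure)
open BIJ88RT51GeneralStep (IsRT511 IsRT511Ax isRT511Ax_single_iff_isRT311 integral_eq_of_isRT511)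
open BIJ88RT311Exists (axialRTData gaussApprox isRT311_rt_of_integrable_ax integrable_rt_of_integrable_ax axialMeasure_eq_map_ax)
open BIJ88RT51NoChange (mulRightPrev measurePreserving_mulRightPrev)
open BIJ88RT51Unique (isRT511_unique isRT511Ax_unique isRT511_congr_ae isRT511Ax_congr_ae)
open BIJ88RT51BlockGauge (isRT511_blockGauge isRT511Ax_blockGauge)
open BIJ88RT51Exists (rt51 measurable_rt51 integrable_rt51 isRT511_rt51 isRT511Ax_rt51)
open BIJ88GaugeAverage (act gaugeAvg measurePreserving_act jointInvariant_gaugeAvg measurable_gaugeAvg integrable_gaugeAvg gaugeAvg_ae_eq)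
open BIJ88BlockGauge417 (qU_gaugeAct_blockConst)
open BIJ85BlockAveragesTorus (qU measurable_qU map_qU_fieldMeasure absolutelyContinuous_map_qU)
open GaugeField (gaugeAct)
open scoped BigOperators ENNReal
open _root_.MeasureTheory _root_.MeasureTheory.Measure Complex Function

noncomputable section

variable {P : Params} {k : ℕ}
variable {ι : Type*} {terms : Finset ι} {Qu : GaugeField P k U1 → GaugeField P (k+1) U1}
variable {Qφ : ι → Prev P k → GaugeField P k U1 → HiggsField P k → HiggsField P (k+1)} {a : ℝ}
variable {ρ' : ι → Prev P k → GaugeField P k U1 → HiggsField P k → ℂ}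

/-! ## §1 Generic: a solution of (5.1.1) stable under the block gauge transformations is a.e. invariant; its gauge average is an exactly
invariant solution -/

section Generic

variable {ρL : GaugeField P (k+1) U1 → HiggsField P (k+1) → ℂ}

/-- kernel: the block-gauge transform `(v, ψ) ↦ ρ̃(v^g, gψ)` of a `dv dψ`-integrable jointly measurable `ρ̃` is `dv dψ`-integrable (the joint
action preserves `dv dψ`, gen 4's `measurePreserving_act`; the skew-product version is gen 4's `BIJ88GaugeAverage.integrable_comp_act`).
[cite: BalabanImbrieJaffe1988, (4.17) p.277] -/
theorem integrable_act_fixed (hm : Measurable (uncurry ρL)) (hi : Integrable (uncurry ρL) ((fieldMeasure P (k+1) U1).prod volume))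
    (g : GaugeTransf P (k+1) U1) :
    Integrable (fun z => uncurry ρL (act g z)) ((fieldMeasure P (k+1) U1).prod volume) :=
  ((measurePreserving_act g).integrable_comp hm.aestronglyMeasurable).2 hi

/-- **A solution of (5.1.1) all of whose block-gauge transforms are solutions is block-gauge invariant ALMOST EVERYWHERE**: for each `g`,
`ρ̃(v^g, gψ) = ρ̃(v, ψ)` for `dv dψ`-a.e. `(v, ψ)` — both sides are `dv dψ`-integrable solutions of (5.1.1) for the same data, and (5.1.1)
determines its solution up to null sets (gen 5's `BIJ88RT51Unique.isRT511_unique`). [cite: BalabanImbrieJaffe1988, (4.17) p.277] -/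
theorem ae_invariant_of_isRT511 (h : IsRT511 terms Qu Qφ a ρ' ρL) (hm : Measurable (uncurry ρL))
    (hi : Integrable (uncurry ρL) ((fieldMeasure P (k+1) U1).prod volume))
    (hcov : ∀ g : GaugeTransf P (k+1) U1, IsRT511 terms Qu Qφ a ρ' fun v ψ => ρL (gaugeAct g v) (twist g ψ))
    (g : GaugeTransf P (k+1) U1) :
    (fun z => uncurry ρL (act g z)) =ᵐ[(fieldMeasure P (k+1) U1).prod volume] uncurry ρL :=
  isRT511_unique (hcov g) h (integrable_act_fixed hm hi g) hi

/-- The same for (5.1.1) with the axial gauge conditions (5.1.4) inserted. [cite: BalabanImbrieJaffe1988, (5.1.4) p.278] -/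
theorem ae_invariant_of_isRT511Ax (h : IsRT511Ax terms Qu Qφ a ρ' ρL) (hm : Measurable (uncurry ρL))
    (hi : Integrable (uncurry ρL) ((fieldMeasure P (k+1) U1).prod volume))
    (hcov : ∀ g : GaugeTransf P (k+1) U1, IsRT511Ax terms Qu Qφ a ρ' fun v ψ => ρL (gaugeAct g v) (twist g ψ))
    (g : GaugeTransf P (k+1) U1) :
    (fun z => uncurry ρL (act g z)) =ᵐ[(fieldMeasure P (k+1) U1).prod volume] uncurry ρL :=
  isRT511Ax_unique (hcov g) h (integrable_act_fixed hm hi g) hi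

/-- **The gauge average of such a solution is an EXACTLY block-gauge invariant solution of (5.1.1)**: `gaugeAvg ρ̃ = ρ̃` a.e. (gen 4's
`gaugeAvg_ae_eq`) and (5.1.1) is insensitive to null modifications (gen 5's `isRT511_congr_ae`); exact invariance is gen 4's
`jointInvariant_gaugeAvg`. [cite: BalabanImbrieJaffe1988, (4.17) p.277] -/
theorem isRT511_gaugeAvg (h : IsRT511 terms Qu Qφ a ρ' ρL) (hm : Measurable (uncurry ρL))
    (hi : Integrable (uncurry ρL) ((fieldMeasure P (k+1) U1).prod volume))
    (hcov : ∀ g : GaugeTransf P (k+1) U1, IsRT511 terms Qu Qφ a ρ' fun v ψ => ρL (gaugeAct g v) (twist g ψ)) :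
    IsRT511 terms Qu Qφ a ρ' (gaugeAvg ρL) :=
  isRT511_congr_ae h hi (integrable_gaugeAvg hm hi) (gaugeAvg_ae_eq hm (ae_invariant_of_isRT511 h hm hi hcov))

/-- The same for (5.1.1) with the axial gauge conditions (5.1.4) inserted. [cite: BalabanImbrieJaffe1988, (5.1.4) p.278] -/
theorem isRT511Ax_gaugeAvg (h : IsRT511Ax terms Qu Qφ a ρ' ρL) (hm : Measurable (uncurry ρL))
    (hi : Integrable (uncurry ρL) ((fieldMeasure P (k+1) U1).prod volume))
    (hcov : ∀ g : GaugeTransf P (k+1) U1, IsRT511Ax terms Qu Qφ a ρ' fun v ψ => ρL (gaugeAct g v) (twist g ψ)) :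
    IsRT511Ax terms Qu Qφ a ρ' (gaugeAvg ρL) :=
  isRT511Ax_congr_ae h hi (integrable_gaugeAvg hm hi) (gaugeAvg_ae_eq hm (ae_invariant_of_isRT511Ax h hm hi hcov))

end Generic

/-! ## §2 The constructed density of (5.1.1): a.e. invariant; its gauge average is an exactly invariant solution -/

section Constructed

/-- **Normalization of the constructed density** (the general-step analogue of (3.13)/(3.7) for the CONSTRUCTED `ρ̃^L_{k+1}`):
`∫dv dψ ρ̃^L_{k+1} = Σ_{t∈terms} ∫𝒟u ∫Π𝒟u^{(j)} ∫𝒟φ ρ′_t` — gen 5's `integral_eq_of_isRT511` with its hypothesis discharged by file 2's `isRT511_rt51`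
(the `ψ`-Gaussian has unit mass by (5.1.2), `δ(v/Qu)` integrates to `1`). [cite: BalabanImbrieJaffe1988, (5.1.2) p.277] -/
theorem integral_rt51 (ha : 0 < a) (hd : 2 ≤ P.d) (hQu : Measurable Qu)
    (hac : (fieldMeasure P k U1).map Qu ≪ fieldMeasure P (k+1) U1)
    (hQφm : ∀ t ∈ terms, Measurable fun p : Prev P k × (GaugeField P k U1 × HiggsField P k) => Qφ t p.1 p.2.1 p.2.2)
    (hρm : ∀ t ∈ terms, Measurable fun p : Prev P k × (GaugeField P k U1 × HiggsField P k) => ρ' t p.1 p.2.1 p.2.2)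
    (hρi : ∀ t ∈ terms, Integrable (fun q : GaugeField P k U1 × (Prev P k × HiggsField P k) => ρ' t q.2.1 q.1 q.2.2)
      ((fieldMeasure P k U1).prod ((prevMeasure P k).prod volume))) :
    ∫ v, ∫ ψ, rt51 (fieldMeasure P k U1) terms Qu Qφ a ρ' v ψ ∂volume ∂fieldMeasure P (k+1) U1 =
      ∑ t ∈ terms, ∫ U, ∫ prev, ∫ φ, ρ' t prev U φ ∂volume ∂prevMeasure P k ∂fieldMeasure P k U1 :=
  integral_eq_of_isRT511 hd ha (isRT511_rt51 ha hd hQu hac hQφm hρm hρi)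

/-- **The constructed density `ρ̃^L_{k+1} = rt51 𝒟u …` of file 2 is block-field gauge invariant almost everywhere**, under the existence
hypotheses of `BIJ88RT51Exists.isRT511_rt51` and the covariance hypotheses of gen 5's `BIJ88RT51BlockGauge.isRT511_blockGauge` — `Qu` block-gauge
covariant (`Q(u^{g∘y}) = (Qu)^g`), and for every term a `Π𝒟u^{(j)}`-preserving reparametrization `τ_t(g)` of the earlier fields (the third line
of (4.17)) under which `ρ′_t` is invariant and the background kernel covariant. [cite: BalabanImbrieJaffe1988, (4.17) p.277] -/
theorem rt51_act_ae_eq (ha : 0 < a) (hd : 2 ≤ P.d) (hQu : Measurable Qu)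
    (hac : (fieldMeasure P k U1).map Qu ≪ fieldMeasure P (k+1) U1)
    (hQφm : ∀ t ∈ terms, Measurable fun p : Prev P k × (GaugeField P k U1 × HiggsField P k) => Qφ t p.1 p.2.1 p.2.2)
    (hρm : ∀ t ∈ terms, Measurable fun p : Prev P k × (GaugeField P k U1 × HiggsField P k) => ρ' t p.1 p.2.1 p.2.2)
    (hρi : ∀ t ∈ terms, Integrable (fun q : GaugeField P k U1 × (Prev P k × HiggsField P k) => ρ' t q.2.1 q.1 q.2.2)
      ((fieldMeasure P k U1).prod ((prevMeasure P k).prod volume)))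
    (hQuCov : ∀ (g : GaugeTransf P (k+1) U1) U, Qu (gaugeAct (fun x => g (blockOf x)) U) = gaugeAct g (Qu U))
    (τ : ι → GaugeTransf P (k+1) U1 → Prev P k ≃ᵐ Prev P k)
    (hτ : ∀ t ∈ terms, ∀ g, MeasurePreserving (τ t g) (prevMeasure P k) (prevMeasure P k))
    (hρ : ∀ t ∈ terms, ∀ (g : GaugeTransf P (k+1) U1) prev U φ,
      ρ' t (τ t g prev) (gaugeAct (fun x => g (blockOf x)) U) (twist (fun x => g (blockOf x)) φ) = ρ' t prev U φ)
    (hQφ : ∀ t ∈ terms, ∀ (g : GaugeTransf P (k+1) U1) prev U φ,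
      Qφ t (τ t g prev) (gaugeAct (fun x => g (blockOf x)) U) (twist (fun x => g (blockOf x)) φ) = twist g (Qφ t prev U φ))
    (g : GaugeTransf P (k+1) U1) :
    (fun z => uncurry (rt51 (fieldMeasure P k U1) terms Qu Qφ a ρ') (act g z)) =ᵐ[(fieldMeasure P (k+1) U1).prod volume]
      uncurry (rt51 (fieldMeasure P k U1) terms Qu Qφ a ρ') :=
  ae_invariant_of_isRT511 (isRT511_rt51 ha hd hQu hac hQφm hρm hρi) measurable_rt51 (integrable_rt51 ha hd hQφm hρm hρi)
    (fun g => isRT511_blockGauge hQuCov τ hτ hρ hQφ (isRT511_rt51 ha hd hQu hac hQφm hρm hρi) g) g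

/-- **THE GAUGE AVERAGE OF THE CONSTRUCTED DENSITY SATISFIES (5.1.1)** (same hypotheses): `IsRT511 terms Qu Qφ a ρ′ (gaugeAvg (rt51 𝒟u …))` —
an exactly block-field gauge invariant density of `ρ̃^L_{k+1}`. [cite: BalabanImbrieJaffe1988, (5.1.1) p.277] -/
theorem isRT511_gaugeAvg_rt51 (ha : 0 < a) (hd : 2 ≤ P.d) (hQu : Measurable Qu)
    (hac : (fieldMeasure P k U1).map Qu ≪ fieldMeasure P (k+1) U1)
    (hQφm : ∀ t ∈ terms, Measurable fun p : Prev P k × (GaugeField P k U1 × HiggsField P k) => Qφ t p.1 p.2.1 p.2.2)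
    (hρm : ∀ t ∈ terms, Measurable fun p : Prev P k × (GaugeField P k U1 × HiggsField P k) => ρ' t p.1 p.2.1 p.2.2)
    (hρi : ∀ t ∈ terms, Integrable (fun q : GaugeField P k U1 × (Prev P k × HiggsField P k) => ρ' t q.2.1 q.1 q.2.2)
      ((fieldMeasure P k U1).prod ((prevMeasure P k).prod volume)))
    (hQuCov : ∀ (g : GaugeTransf P (k+1) U1) U, Qu (gaugeAct (fun x => g (blockOf x)) U) = gaugeAct g (Qu U))
    (τ : ι → GaugeTransf P (k+1) U1 → Prev P k ≃ᵐ Prev P k)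
    (hτ : ∀ t ∈ terms, ∀ g, MeasurePreserving (τ t g) (prevMeasure P k) (prevMeasure P k))
    (hρ : ∀ t ∈ terms, ∀ (g : GaugeTransf P (k+1) U1) prev U φ,
      ρ' t (τ t g prev) (gaugeAct (fun x => g (blockOf x)) U) (twist (fun x => g (blockOf x)) φ) = ρ' t prev U φ)
    (hQφ : ∀ t ∈ terms, ∀ (g : GaugeTransf P (k+1) U1) prev U φ,
      Qφ t (τ t g prev) (gaugeAct (fun x => g (blockOf x)) U) (twist (fun x => g (blockOf x)) φ) = twist g (Qφ t prev U φ)) :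
    IsRT511 terms Qu Qφ a ρ' (gaugeAvg (rt51 (fieldMeasure P k U1) terms Qu Qφ a ρ')) :=
  isRT511_gaugeAvg (isRT511_rt51 ha hd hQu hac hQφm hρm hρi) measurable_rt51 (integrable_rt51 ha hd hQφm hρm hρi)
    fun g => isRT511_blockGauge hQuCov τ hτ hρ hQφ (isRT511_rt51 ha hd hQu hac hQφm hρm hρi) g

/-- **EXISTENCE OF AN EXACTLY BLOCK-FIELD GAUGE INVARIANT DENSITY `ρ̃^L_{k+1}` SATISFYING (5.1.1)** (p. 277 (4.17) *"block field gauge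
invariance"*; Sect. 5.2 keeps *"this restricted gauge invariance … in all subsequent operations"* — here for the operation (5.1.1)): under the
hypotheses above there is `ρ̃` with `IsRT511 terms Qu Qφ a ρ′ ρ̃`, `ρ̃(v^g, gψ) = ρ̃(v, ψ)` for ALL `g`, `v`, `ψ` (`BIJ85RT33.JointInvariant`), jointly
measurable and `dv dψ`-integrable — namely the gauge average of the constructed density. [cite: BalabanImbrieJaffe1988, (5.1.1) p.277] -/
theorem exists_isRT511_jointInvariant (ha : 0 < a) (hd : 2 ≤ P.d) (hQu : Measurable Qu)
    (hac : (fieldMeasure P k U1).map Qu ≪ fieldMeasure P (k+1) U1)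
    (hQφm : ∀ t ∈ terms, Measurable fun p : Prev P k × (GaugeField P k U1 × HiggsField P k) => Qφ t p.1 p.2.1 p.2.2)
    (hρm : ∀ t ∈ terms, Measurable fun p : Prev P k × (GaugeField P k U1 × HiggsField P k) => ρ' t p.1 p.2.1 p.2.2)
    (hρi : ∀ t ∈ terms, Integrable (fun q : GaugeField P k U1 × (Prev P k × HiggsField P k) => ρ' t q.2.1 q.1 q.2.2)
      ((fieldMeasure P k U1).prod ((prevMeasure P k).prod volume)))
    (hQuCov : ∀ (g : GaugeTransf P (k+1) U1) U, Qu (gaugeAct (fun x => g (blockOf x)) U) = gaugeAct g (Qu U))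
    (τ : ι → GaugeTransf P (k+1) U1 → Prev P k ≃ᵐ Prev P k)
    (hτ : ∀ t ∈ terms, ∀ g, MeasurePreserving (τ t g) (prevMeasure P k) (prevMeasure P k))
    (hρ : ∀ t ∈ terms, ∀ (g : GaugeTransf P (k+1) U1) prev U φ,
      ρ' t (τ t g prev) (gaugeAct (fun x => g (blockOf x)) U) (twist (fun x => g (blockOf x)) φ) = ρ' t prev U φ)
    (hQφ : ∀ t ∈ terms, ∀ (g : GaugeTransf P (k+1) U1) prev U φ,
      Qφ t (τ t g prev) (gaugeAct (fun x => g (blockOf x)) U) (twist (fun x => g (blockOf x)) φ) = twist g (Qφ t prev U φ)) :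
    ∃ ρL : GaugeField P (k+1) U1 → HiggsField P (k+1) → ℂ,
      IsRT511 terms Qu Qφ a ρ' ρL ∧ JointInvariant ρL ∧ Measurable (uncurry ρL) ∧
        Integrable (uncurry ρL) ((fieldMeasure P (k+1) U1).prod volume) :=
  ⟨gaugeAvg (rt51 (fieldMeasure P k U1) terms Qu Qφ a ρ'),
    isRT511_gaugeAvg_rt51 ha hd hQu hac hQφm hρm hρi hQuCov τ hτ hρ hQφ, jointInvariant_gaugeAvg _,
    measurable_gaugeAvg measurable_rt51, integrable_gaugeAvg measurable_rt51 (integrable_rt51 ha hd hQφm hρm hρi)⟩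

/-- The axial version: **the constructed density `rt51 (𝒟u δ_{Ax}) …` of (5.1.1)-with-(5.1.4) is block-field gauge invariant a.e.** (gen 5's
`isRT511Ax_blockGauge`, standing range; Haar regularity and integrability for `𝒟u δ_{Ax}`). [cite: BalabanImbrieJaffe1988, (5.1.4) p.278] -/
theorem rt51Ax_act_ae_eq (hk : k + 1 ≤ P.m + P.K) (ha : 0 < a) (hd : 2 ≤ P.d) (hQu : Measurable Qu)
    (hac : (axialMeasure P k U1).map Qu ≪ fieldMeasure P (k+1) U1)
    (hQφm : ∀ t ∈ terms, Measurable fun p : Prev P k × (GaugeField P k U1 × HiggsField P k) => Qφ t p.1 p.2.1 p.2.2)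
    (hρm : ∀ t ∈ terms, Measurable fun p : Prev P k × (GaugeField P k U1 × HiggsField P k) => ρ' t p.1 p.2.1 p.2.2)
    (hρi : ∀ t ∈ terms, Integrable (fun q : GaugeField P k U1 × (Prev P k × HiggsField P k) => ρ' t q.2.1 q.1 q.2.2)
      ((axialMeasure P k U1).prod ((prevMeasure P k).prod volume)))
    (hQuCov : ∀ (g : GaugeTransf P (k+1) U1) U, Qu (gaugeAct (fun x => g (blockOf x)) U) = gaugeAct g (Qu U))
    (τ : ι → GaugeTransf P (k+1) U1 → Prev P k ≃ᵐ Prev P k)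
    (hτ : ∀ t ∈ terms, ∀ g, MeasurePreserving (τ t g) (prevMeasure P k) (prevMeasure P k))
    (hρ : ∀ t ∈ terms, ∀ (g : GaugeTransf P (k+1) U1) prev U φ,
      ρ' t (τ t g prev) (gaugeAct (fun x => g (blockOf x)) U) (twist (fun x => g (blockOf x)) φ) = ρ' t prev U φ)
    (hQφ : ∀ t ∈ terms, ∀ (g : GaugeTransf P (k+1) U1) prev U φ,
      Qφ t (τ t g prev) (gaugeAct (fun x => g (blockOf x)) U) (twist (fun x => g (blockOf x)) φ) = twist g (Qφ t prev U φ))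
    (g : GaugeTransf P (k+1) U1) :
    (fun z => uncurry (rt51 (axialMeasure P k U1) terms Qu Qφ a ρ') (act g z)) =ᵐ[(fieldMeasure P (k+1) U1).prod volume]
      uncurry (rt51 (axialMeasure P k U1) terms Qu Qφ a ρ') :=
  ae_invariant_of_isRT511Ax (isRT511Ax_rt51 ha hd hQu hac hQφm hρm hρi) measurable_rt51 (integrable_rt51 ha hd hQφm hρm hρi)
    (fun g => isRT511Ax_blockGauge hk hQuCov τ hτ hρ hQφ (isRT511Ax_rt51 ha hd hQu hac hQφm hρm hρi) g) g

/-- The axial version: **the gauge average of `rt51 (𝒟u δ_{Ax}) …` satisfies (5.1.1)-with-(5.1.4)**, `IsRT511Ax`.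
[cite: BalabanImbrieJaffe1988, (5.1.4) p.278] -/
theorem isRT511Ax_gaugeAvg_rt51 (hk : k + 1 ≤ P.m + P.K) (ha : 0 < a) (hd : 2 ≤ P.d) (hQu : Measurable Qu)
    (hac : (axialMeasure P k U1).map Qu ≪ fieldMeasure P (k+1) U1)
    (hQφm : ∀ t ∈ terms, Measurable fun p : Prev P k × (GaugeField P k U1 × HiggsField P k) => Qφ t p.1 p.2.1 p.2.2)
    (hρm : ∀ t ∈ terms, Measurable fun p : Prev P k × (GaugeField P k U1 × HiggsField P k) => ρ' t p.1 p.2.1 p.2.2)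
    (hρi : ∀ t ∈ terms, Integrable (fun q : GaugeField P k U1 × (Prev P k × HiggsField P k) => ρ' t q.2.1 q.1 q.2.2)
      ((axialMeasure P k U1).prod ((prevMeasure P k).prod volume)))
    (hQuCov : ∀ (g : GaugeTransf P (k+1) U1) U, Qu (gaugeAct (fun x => g (blockOf x)) U) = gaugeAct g (Qu U))
    (τ : ι → GaugeTransf P (k+1) U1 → Prev P k ≃ᵐ Prev P k)
    (hτ : ∀ t ∈ terms, ∀ g, MeasurePreserving (τ t g) (prevMeasure P k) (prevMeasure P k))
    (hρ : ∀ t ∈ terms, ∀ (g : GaugeTransf P (k+1) U1) prev U φ,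
      ρ' t (τ t g prev) (gaugeAct (fun x => g (blockOf x)) U) (twist (fun x => g (blockOf x)) φ) = ρ' t prev U φ)
    (hQφ : ∀ t ∈ terms, ∀ (g : GaugeTransf P (k+1) U1) prev U φ,
      Qφ t (τ t g prev) (gaugeAct (fun x => g (blockOf x)) U) (twist (fun x => g (blockOf x)) φ) = twist g (Qφ t prev U φ)) :
    IsRT511Ax terms Qu Qφ a ρ' (gaugeAvg (rt51 (axialMeasure P k U1) terms Qu Qφ a ρ')) :=
  isRT511Ax_gaugeAvg (isRT511Ax_rt51 ha hd hQu hac hQφm hρm hρi) measurable_rt51 (integrable_rt51 ha hd hQφm hρm hρi)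
    fun g => isRT511Ax_blockGauge hk hQuCov τ hτ hρ hQφ (isRT511Ax_rt51 ha hd hQu hac hQφm hρm hρi) g

/-- The axial version of the existence of an exactly invariant solution: `∃ ρ̃`, `IsRT511Ax terms Qu Qφ a ρ′ ρ̃ ∧ JointInvariant ρ̃ ∧`
measurable `∧` `dv dψ`-integrable. [cite: BalabanImbrieJaffe1988, (5.1.4) p.278] -/
theorem exists_isRT511Ax_jointInvariant (hk : k + 1 ≤ P.m + P.K) (ha : 0 < a) (hd : 2 ≤ P.d) (hQu : Measurable Qu)
    (hac : (axialMeasure P k U1).map Qu ≪ fieldMeasure P (k+1) U1)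
    (hQφm : ∀ t ∈ terms, Measurable fun p : Prev P k × (GaugeField P k U1 × HiggsField P k) => Qφ t p.1 p.2.1 p.2.2)
    (hρm : ∀ t ∈ terms, Measurable fun p : Prev P k × (GaugeField P k U1 × HiggsField P k) => ρ' t p.1 p.2.1 p.2.2)
    (hρi : ∀ t ∈ terms, Integrable (fun q : GaugeField P k U1 × (Prev P k × HiggsField P k) => ρ' t q.2.1 q.1 q.2.2)
      ((axialMeasure P k U1).prod ((prevMeasure P k).prod volume)))
    (hQuCov : ∀ (g : GaugeTransf P (k+1) U1) U, Qu (gaugeAct (fun x => g (blockOf x)) U) = gaugeAct g (Qu U))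
    (τ : ι → GaugeTransf P (k+1) U1 → Prev P k ≃ᵐ Prev P k)
    (hτ : ∀ t ∈ terms, ∀ g, MeasurePreserving (τ t g) (prevMeasure P k) (prevMeasure P k))
    (hρ : ∀ t ∈ terms, ∀ (g : GaugeTransf P (k+1) U1) prev U φ,
      ρ' t (τ t g prev) (gaugeAct (fun x => g (blockOf x)) U) (twist (fun x => g (blockOf x)) φ) = ρ' t prev U φ)
    (hQφ : ∀ t ∈ terms, ∀ (g : GaugeTransf P (k+1) U1) prev U φ,
      Qφ t (τ t g prev) (gaugeAct (fun x => g (blockOf x)) U) (twist (fun x => g (blockOf x)) φ) = twist g (Qφ t prev U φ)) :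
    ∃ ρL : GaugeField P (k+1) U1 → HiggsField P (k+1) → ℂ,
      IsRT511Ax terms Qu Qφ a ρ' ρL ∧ JointInvariant ρL ∧ Measurable (uncurry ρL) ∧
        Integrable (uncurry ρL) ((fieldMeasure P (k+1) U1).prod volume) :=
  ⟨gaugeAvg (rt51 (axialMeasure P k U1) terms Qu Qφ a ρ'),
    isRT511Ax_gaugeAvg_rt51 hk ha hd hQu hac hQφm hρm hρi hQuCov τ hτ hρ hQφ, jointInvariant_gaugeAvg _,
    measurable_gaugeAvg measurable_rt51, integrable_gaugeAvg measurable_rt51 (integrable_rt51 ha hd hQφm hρm hρi)⟩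

end Constructed

/-! ## §3 The printed instance: `Qu` = [2] (2.10), the earlier fields reparametrized in the shape of (4.17) -/

section Printed

/-- **EXISTENCE OF AN EXACTLY INVARIANT `ρ̃^L_{k+1}` FOR THE PRINTED GAUGE-FIELD AVERAGE `Qu`** ([2] (2.10) on the torus of record, r18's
`BIJ85BlockAveragesTorus.qU`: Haar regularity `map_qU_fieldMeasure`, block-gauge covariance `BIJ88BlockGauge417.qU_gaugeAct_blockConst`; standing
range) with the earlier fields reparametrized bondwise in the SHAPE of the third line of (4.17) (`mulRightPrev (w_t g)`, `Π𝒟u^{(j)}`-preserving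
for every prescription `w`, gen 5): only the invariance of `ρ′_t` and the covariance of `Q_t = Q(u_k)φ` under these maps, and the measurability /
integrability of the term data, remain as hypotheses. [cite: BalabanImbrieJaffe1988, (4.17) p.277] -/
theorem exists_isRT511_jointInvariant_printed (hk : k + 1 ≤ P.m + P.K) (ha : 0 < a) (hd : 2 ≤ P.d)
    (hQφm : ∀ t ∈ terms, Measurable fun p : Prev P k × (GaugeField P k U1 × HiggsField P k) => Qφ t p.1 p.2.1 p.2.2)
    (hρm : ∀ t ∈ terms, Measurable fun p : Prev P k × (GaugeField P k U1 × HiggsField P k) => ρ' t p.1 p.2.1 p.2.2)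
    (hρi : ∀ t ∈ terms, Integrable (fun q : GaugeField P k U1 × (Prev P k × HiggsField P k) => ρ' t q.2.1 q.1 q.2.2)
      ((fieldMeasure P k U1).prod ((prevMeasure P k).prod volume)))
    (w : ι → GaugeTransf P (k+1) U1 → (i : Fin k) → PBond P i → U1)
    (hρ : ∀ t ∈ terms, ∀ (g : GaugeTransf P (k+1) U1) prev U φ,
      ρ' t (mulRightPrev (w t g) prev) (gaugeAct (fun x => g (blockOf x)) U) (twist (fun x => g (blockOf x)) φ) = ρ' t prev U φ)
    (hQφ : ∀ t ∈ terms, ∀ (g : GaugeTransf P (k+1) U1) prev U φ,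
      Qφ t (mulRightPrev (w t g) prev) (gaugeAct (fun x => g (blockOf x)) U) (twist (fun x => g (blockOf x)) φ) =
        twist g (Qφ t prev U φ)) :
    ∃ ρL : GaugeField P (k+1) U1 → HiggsField P (k+1) → ℂ,
      IsRT511 terms qU Qφ a ρ' ρL ∧ JointInvariant ρL ∧ Measurable (uncurry ρL) ∧
        Integrable (uncurry ρL) ((fieldMeasure P (k+1) U1).prod volume) :=
  exists_isRT511_jointInvariant ha hd measurable_qU (Measure.absolutelyContinuous_of_eq (map_qU_fieldMeasure hk)) hQφm hρm hρi
    (qU_gaugeAct_blockConst hk) (fun t g => mulRightPrev (w t g)) (fun t _ g => measurePreserving_mulRightPrev (w t g)) hρ hQφ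

/-- The axial version for the printed `Qu` (Haar regularity in the axial gauge `absolutelyContinuous_map_qU`).
[cite: BalabanImbrieJaffe1988, (5.1.4) p.278] -/
theorem exists_isRT511Ax_jointInvariant_printed (hk : k + 1 ≤ P.m + P.K) (ha : 0 < a) (hd : 2 ≤ P.d)
    (hQφm : ∀ t ∈ terms, Measurable fun p : Prev P k × (GaugeField P k U1 × HiggsField P k) => Qφ t p.1 p.2.1 p.2.2)
    (hρm : ∀ t ∈ terms, Measurable fun p : Prev P k × (GaugeField P k U1 × HiggsField P k) => ρ' t p.1 p.2.1 p.2.2)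
    (hρi : ∀ t ∈ terms, Integrable (fun q : GaugeField P k U1 × (Prev P k × HiggsField P k) => ρ' t q.2.1 q.1 q.2.2)
      ((axialMeasure P k U1).prod ((prevMeasure P k).prod volume)))
    (w : ι → GaugeTransf P (k+1) U1 → (i : Fin k) → PBond P i → U1)
    (hρ : ∀ t ∈ terms, ∀ (g : GaugeTransf P (k+1) U1) prev U φ,
      ρ' t (mulRightPrev (w t g) prev) (gaugeAct (fun x => g (blockOf x)) U) (twist (fun x => g (blockOf x)) φ) = ρ' t prev U φ)
    (hQφ : ∀ t ∈ terms, ∀ (g : GaugeTransf P (k+1) U1) prev U φ,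
      Qφ t (mulRightPrev (w t g) prev) (gaugeAct (fun x => g (blockOf x)) U) (twist (fun x => g (blockOf x)) φ) =
        twist g (Qφ t prev U φ)) :
    ∃ ρL : GaugeField P (k+1) U1 → HiggsField P (k+1) → ℂ,
      IsRT511Ax terms qU Qφ a ρ' ρL ∧ JointInvariant ρL ∧ Measurable (uncurry ρL) ∧
        Integrable (uncurry ρL) ((fieldMeasure P (k+1) U1).prod volume) :=
  exists_isRT511Ax_jointInvariant hk ha hd measurable_qU (absolutelyContinuous_map_qU hk) hQφm hρm hρi
    (qU_gaugeAct_blockConst hk) (fun t g => mulRightPrev (w t g)) (fun t _ g => measurePreserving_mulRightPrev (w t g)) hρ hQφ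

end Printed

/-! ## §4 Consistency with the first step: one history-free term gives back the (3.3)/(3.11) density of [2] -/

section FirstStep

/-- **CONSISTENCY WITH [2] (3.3) / (3.11)**: for a single term whose data ignore the earlier fields (the first step: (3.11) is (5.1.1) with no
history, gen 5's `isRT511Ax_single_iff_isRT311`), the general-step construction `rt51 (𝒟u δ_{Ax}) {•} Qu Q(·)φ a ρ₀` coincides `dv dψ`-almost
everywhere with gen 2's measure-level renormalization transform `𝒯ρ₀ = RTData.rt` of [BalabanImbrieJaffe1985] (3.3) over r18's axial forest
(`BIJ88RT311Exists.axialRTData`, `isRT311_rt_of_integrable_ax`): both are `dv dψ`-integrable solutions of r18's typed (3.11), which determines its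
solution up to null sets.  Hypotheses: measurable Haar-regular `Qu` (axial form), measurable `Q(·)φ`, `ρ₀` jointly measurable and
`𝒟u δ_{Ax} ⊗ 𝒟φ`-integrable, `a > 0`, `d ≥ 2`, standing range. [cite: BalabanImbrieJaffe1988, (3.11) p.266] -/
theorem rt51_single_ae_eq_rt (hk : k + 1 ≤ P.m + P.K) (ha : 0 < a) (hd : 2 ≤ P.d) (hQu : Measurable Qu)
    (hac : (axialMeasure P k U1).map Qu ≪ fieldMeasure P (k+1) U1)
    {Qφ₀ : GaugeField P k U1 → HiggsField P k → HiggsField P (k+1)} (hQφ₀ : Measurable (uncurry Qφ₀))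
    {ρ₀ : GaugeField P k U1 → HiggsField P k → ℂ} (hρm : Measurable (uncurry ρ₀))
    (hρi : Integrable (uncurry ρ₀) ((axialMeasure P k U1).prod volume)) :
    uncurry (rt51 (axialMeasure P k U1) (Finset.univ : Finset Unit) Qu (fun _ _ => Qφ₀) a (fun _ _ => ρ₀))
      =ᵐ[(fieldMeasure P (k+1) U1).prod volume]
        uncurry ((axialRTData hk Qu hQu Qφ₀ hQφ₀ hac).rt (gaussApprox ha hd) ρ₀) := by
  -- `ρ₀` integrable in the axial gauge, in the pulled-back form of gen 2 (`u ↦ u[T := 1]` under `𝒟u`) …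
  have hax : axialMeasure P k U1 = (fieldMeasure P k U1).map (axialRTData hk Qu hQu Qφ₀ hQφ₀ hac).ax :=
    axialMeasure_eq_map_ax (D := axialRTData hk Qu hQu Qφ₀ hQφ₀ hac) rfl
  have hπ₀ : MeasurePreserving (axialRTData hk Qu hQu Qφ₀ hQφ₀ hac).ax (fieldMeasure P k U1)
      ((fieldMeasure P k U1).map (axialRTData hk Qu hQu Qφ₀ hQφ₀ hac).ax) :=
    ⟨(axialRTData hk Qu hQu Qφ₀ hQφ₀ hac).measurable_ax, rfl⟩
  have hρif : Integrable (uncurry ρ₀) (((fieldMeasure P k U1).map (axialRTData hk Qu hQu Qφ₀ hQφ₀ hac).ax).prod volume) := by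
    rw [← hax]
    exact hρi
  have hρa : Integrable (uncurry fun U φ => ρ₀ ((axialRTData hk Qu hQu Qφ₀ hQφ₀ hac).ax U) φ) ((fieldMeasure P k U1).prod volume) :=
    ((hπ₀.prod (MeasurePreserving.id volume)).integrable_comp hρif.aestronglyMeasurable).2 hρif
  -- … and in the form of file 2 (the `Π𝒟u^{(j)}`-integral of a constant)
  have hσ : MeasurePreserving (Prod.map id Prod.snd : GaugeField P k U1 × (Prev P k × HiggsField P k) → GaugeField P k U1 × HiggsField P k)
      ((axialMeasure P k U1).prod ((prevMeasure P k).prod volume)) ((axialMeasure P k U1).prod volume) :=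
    (MeasurePreserving.id _).prod measurePreserving_snd
  have hρi' : Integrable (fun q : GaugeField P k U1 × (Prev P k × HiggsField P k) => ρ₀ q.1 q.2.2)
      ((axialMeasure P k U1).prod ((prevMeasure P k).prod volume)) :=
    (hσ.integrable_comp hρi.aestronglyMeasurable).2 hρi
  have hQφ' : ∀ t ∈ (Finset.univ : Finset Unit),
      Measurable fun p : Prev P k × (GaugeField P k U1 × HiggsField P k) => (fun (_ : Unit) (_ : Prev P k) => Qφ₀) t p.1 p.2.1 p.2.2 :=
    fun _ _ => hQφ₀.comp measurable_snd
  have hρm' : ∀ t ∈ (Finset.univ : Finset Unit),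
      Measurable fun p : Prev P k × (GaugeField P k U1 × HiggsField P k) => (fun (_ : Unit) (_ : Prev P k) => ρ₀) t p.1 p.2.1 p.2.2 :=
    fun _ _ => hρm.comp measurable_snd
  have hρi'' : ∀ t ∈ (Finset.univ : Finset Unit),
      Integrable (fun q : GaugeField P k U1 × (Prev P k × HiggsField P k) => (fun (_ : Unit) (_ : Prev P k) => ρ₀) t q.2.1 q.1 q.2.2)
      ((axialMeasure P k U1).prod ((prevMeasure P k).prod volume)) := fun _ _ => hρi'
  -- both densities are integrable solutions of (3.11) = (5.1.1)-with-(5.1.4) for one history-free term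
  have h1 := isRT511Ax_rt51 (terms := (Finset.univ : Finset Unit)) (Qφ := fun (_ : Unit) (_ : Prev P k) => Qφ₀)
    (ρ' := fun (_ : Unit) (_ : Prev P k) => ρ₀) ha hd hQu hac hQφ' hρm' hρi''
  have h2 : IsRT511Ax (Finset.univ : Finset Unit) Qu (fun _ _ => Qφ₀) a (fun _ _ => ρ₀)
      ((axialRTData hk Qu hQu Qφ₀ hQφ₀ hac).rt (gaussApprox ha hd) ρ₀) :=
    (isRT511Ax_single_iff_isRT311 Qu Qφ₀ a ρ₀ _).2
      (isRT311_rt_of_integrable_ax ha hd (axialRTData hk Qu hQu Qφ₀ hQφ₀ hac) rfl hρm hρa)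
  exact isRT511Ax_unique h1 h2
    (integrable_rt51 (ν := axialMeasure P k U1) (terms := (Finset.univ : Finset Unit)) (Qu := Qu)
      (Qφ := fun (_ : Unit) (_ : Prev P k) => Qφ₀) (ρ' := fun (_ : Unit) (_ : Prev P k) => ρ₀) ha hd hQφ' hρm' hρi'')
    (integrable_rt_of_integrable_ax hρm hρa)

end FirstStep

end

end Literature.MathematicalPhysics.QuantumFieldTheory.BalabanImbrieJaffe1984to88.BIJ88RT51Invariant
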